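import Summits.ValiantsHypothesis.ValiantsHypothesis.Theorems.BarrierLeverDiagonalPencilCoeff
import Summits.ValiantsHypothesis.ValiantsHypothesis.Theorems.BarrierLeverNaturalProofsAgainstAllLinearSizesOfCountSize
import Literature.Barriers.ValiantsHypothesis.AlgebraicNaturalProofs

/-!
# Route BarrierLever — the universal-witness arrow `PrincipalMinorLayoutsNonsingular ⇒
# PartitionMinorsHitByVP` (items stmt-ValiantsHypothesis-19133 / -19717 / -19126)

The universal witness for minors of Nisan's partition matrix (cell `valiant-natproofs`, rung V4,
planner p1-g8): for a numeric `K ∈ ℂ^{2h×2h}` put `f_K := det (1 + diag(x, y) · K)` (`pencil K`).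

* `pencil_mem_smallCircuits` — `deg f_K ≤ 2h` (entries of degree `≤ 1`, `totalDegree_det_le_card`)
  and `L(f_K) ≤ 8(2h+1)^7 + 2(2h)^2 ≤ (2h)^10` for `h ≥ 8` (entries of complexity `≤ 2`, Berkowitz via
  `complexity_det_le`), so `f_K ∈ SmallCircuits ℂ (h+h) 10`;
* `coeff_det_pencil` / `mono_eq_indicator` — the coefficient of `x^u y^w` in `f_K` is the principal
  minor `det K[u ⊔ w]` (item `DiagonalPencilCoeff`, stmt-19127, file `…DiagonalPencilCoeff.lean`; the
  `x`- and `y`-index images `castAdd`/`natAdd` are disjoint);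
* **`partitionMinorsHitByVP_of_principalMinorLayoutsNonsingular`** — hypothesis = item
  `PrincipalMinorLayoutsNonsingular` (stmt-19126, "TNS") verbatim, conclusion = item
  `PartitionMinorsHitByVP` (stmt-19717) verbatim, with `b = 10`, `h₀ = 8`. This is item
  `PrincipalMinorLayoutsNonsingularSuffices` (stmt-19133) with its conclusion INLINED: as filed,
  19133 names the route decl `Theses.BarrierLever.PartitionMinorsHitByVP` and is rendered BLOCKED in
  the route file (a closer importing the route file would create an import cycle); once the planner
  restates 19133 in this inlined form, this theorem closes it by `workitem close`.

WHAT THIS IS NOT: TNS (stmt-19126) is NOT proved here — it is the open combinatorial core (censuses: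
0 singular layouts through `h = 7`); hence neither is `PartitionMinorsHitByVP`; nothing on FSV
Question 6 / crux stmt-14610.

References: [ForbesShpilkaVolk2018] §8 (partition-matrix rank methods); Horn–Johnson §0.8.12;
Nisan 1991 (partition matrices); [Burgisser2000] §2.1 (size measure).
-/

-- layout Summits/ValiantsHypothesis/ValiantsHypothesis forces the duplicated namespace component
set_option linter.dupNamespace false

namespace Summit.ValiantsHypothesis.ValiantsHypothesis.Theorems.BarrierLever.DiagonalPencil

open MvPolynomial Matrix Finset Literature.Barriers.ValiantsHypothesis
open Literature.Computability.AlgebraicComplexity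
open Summit.ValiantsHypothesis.ValiantsHypothesis.Theorems.BarrierLever.NaturalProofsAgainstAllLinearSizes
  (totalDegree_det_le_card complexity_det_le)

/-- The diagonal pencil `1 + diag(z₁, …, z_m) · K` of a numeric matrix `K` (its determinant is the
universal witness `f_K`). -/
noncomputable def pencil {m : ℕ} (K : Matrix (Fin m) (Fin m) ℂ) :
    Matrix (Fin m) (Fin m) (MvPolynomial (Fin m) ℂ) :=
  1 + Matrix.diagonal (fun i : Fin m => (X i : MvPolynomial (Fin m) ℂ)) * K.map C

/-- `coeff_{z^S} det (pencil K) = det K[S]` (`diagonalPencilCoeff`, restated for `pencil`). -/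
theorem coeff_det_pencil {m : ℕ} (K : Matrix (Fin m) (Fin m) ℂ) (S : Finset (Fin m)) :
    MvPolynomial.coeff (∑ i ∈ S, Finsupp.single i 1) (pencil K).det =
      (K.submatrix (Subtype.val : ↥S → Fin m) (Subtype.val : ↥S → Fin m)).det :=
  diagonalPencilCoeff m K S

/-- The entries of the pencil. -/
theorem pencil_entry {m : ℕ} (K : Matrix (Fin m) (Fin m) ℂ) (i j : Fin m) :
    (pencil K) i j =
      (if i = j then 1 else 0) + X i * C (K i j) := by
  simp [pencil, Matrix.diagonal_mul, Matrix.one_apply]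

/-- Every entry of `1 + diag(z) K` has degree `≤ 1`. -/
theorem totalDegree_pencil_entry_le {m : ℕ} (K : Matrix (Fin m) (Fin m) ℂ) (i j : Fin m) :
    ((pencil K) i j).totalDegree ≤ 1 := by
  rw [pencil_entry]
  refine (totalDegree_add _ _).trans (max_le ?_ ?_)
  · split_ifs <;> simp
  · refine (totalDegree_mul _ _).trans ?_
    rw [totalDegree_X, totalDegree_C]

/-- Every entry of `1 + diag(z) K` has complexity `≤ 2`. -/
theorem complexity_pencil_entry_le {m : ℕ} (K : Matrix (Fin m) (Fin m) ℂ) (i j : Fin m) :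
    complexity ((pencil K) i j) ≤ 2 := by
  rw [pencil_entry]
  have h1 : complexity ((if i = j then 1 else 0 : MvPolynomial (Fin m) ℂ)) = 0 := by
    split_ifs
    · rw [← C_1]; exact complexity_C_holds _
    · rw [← C_0]; exact complexity_C_holds _
  have h2 : complexity (X i * C (K i j) : MvPolynomial (Fin m) ℂ) ≤ 1 := by
    refine (complexity_mul_le_holds _ _).trans ?_
    rw [complexity_X_holds, complexity_C_holds]
  refine (complexity_add_le_holds _ _).trans ?_
  omega

/-- `deg f_K ≤ m`. -/
theorem totalDegree_pencil_le {m : ℕ} (K : Matrix (Fin m) (Fin m) ℂ) :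
    (pencil K).det.totalDegree ≤ m := by
  have h := totalDegree_det_le_card _ (totalDegree_pencil_entry_le K)
  rwa [Fintype.card_fin] at h

/-- `L(f_K) ≤ 8(m+1)^7 + 2m²`. -/
theorem complexity_pencil_le {m : ℕ} (K : Matrix (Fin m) (Fin m) ℂ) :
    complexity (pencil K).det ≤
      8 * (m + 1) ^ 7 + m ^ 2 * 2 := by
  have h := complexity_det_le _ 2 (complexity_pencil_entry_le K)
  rwa [Fintype.card_fin] at h

/-- The size bookkeeping: `8(2h+1)^7 + 2(2h)² ≤ (2h)^10` for `h ≥ 8`. -/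
theorem pencil_size_arith {h : ℕ} (hh : 8 ≤ h) :
    8 * (h + h + 1) ^ 7 + (h + h) ^ 2 * 2 ≤ (h + h) ^ 10 := by
  have h1 : h + h + 1 ≤ 4 * h := by omega
  have h2 : 8 * (h + h + 1) ^ 7 ≤ 2 ^ 17 * h ^ 7 := by
    calc 8 * (h + h + 1) ^ 7 ≤ 8 * (4 * h) ^ 7 := Nat.mul_le_mul_left _ (Nat.pow_le_pow_left h1 7)
      _ = 2 ^ 17 * h ^ 7 := by ring
  have h3 : (h + h) ^ 2 * 2 ≤ 2 ^ 17 * h ^ 7 := by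
    have : h ^ 2 ≤ h ^ 7 := Nat.pow_le_pow_right (by omega) (by norm_num)
    calc (h + h) ^ 2 * 2 = 8 * h ^ 2 := by ring
      _ ≤ 2 ^ 17 * h ^ 7 := by
        calc 8 * h ^ 2 ≤ 8 * h ^ 7 := Nat.mul_le_mul_left _ this
          _ ≤ 2 ^ 17 * h ^ 7 := Nat.mul_le_mul_right _ (by norm_num)
  have h4 : 2 ^ 8 ≤ h ^ 3 := by
    calc 2 ^ 8 ≤ 8 ^ 3 := by norm_num
      _ ≤ h ^ 3 := Nat.pow_le_pow_left hh 3
  calc 8 * (h + h + 1) ^ 7 + (h + h) ^ 2 * 2 ≤ 2 ^ 17 * h ^ 7 + 2 ^ 17 * h ^ 7 := add_le_add h2 h3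
    _ = 2 ^ 10 * 2 ^ 8 * h ^ 7 := by ring
    _ ≤ 2 ^ 10 * h ^ 3 * h ^ 7 := Nat.mul_le_mul_right _ (Nat.mul_le_mul_left _ h4)
    _ = (h + h) ^ 10 := by ring

/-- `f_K ∈ SmallCircuits ℂ (h+h) 10` for `h ≥ 8`. -/
theorem pencil_mem_smallCircuits {h : ℕ} (hh : 8 ≤ h) (K : Matrix (Fin (h + h)) (Fin (h + h)) ℂ) :
    (pencil K).det ∈
      SmallCircuits ℂ (h + h) 10 :=
  ⟨totalDegree_pencil_le K, (complexity_pencil_le K).trans (pencil_size_arith hh)⟩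

/-- The exponent vector of `x^u y^w` is the indicator of the (disjoint) union of the two index
images. -/
theorem mono_eq_indicator (h : ℕ) (u w : Finset (Fin h)) :
    (∑ a ∈ u, Finsupp.single (Fin.castAdd h a) 1 + ∑ c ∈ w, Finsupp.single (Fin.natAdd h c) 1 :
        Fin (h + h) →₀ ℕ) =
      ∑ i ∈ u.map (Fin.castAddEmb h) ∪ w.map (Fin.natAddEmb h), Finsupp.single i 1 := by
  have hdisj : Disjoint (u.map (Fin.castAddEmb h)) (w.map (Fin.natAddEmb h)) := by
    rw [Finset.disjoint_left]
    intro x hx hx'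
    obtain ⟨a, -, rfl⟩ := Finset.mem_map.1 hx
    obtain ⟨c, -, hc⟩ := Finset.mem_map.1 hx'
    have h1 := congrArg Fin.val hc
    simp [Fin.castAddEmb, Fin.natAddEmb] at h1
    omega
  rw [Finset.sum_union hdisj, Finset.sum_map, Finset.sum_map]
  rfl

/-- **The universal-witness arrow `PrincipalMinorLayoutsNonsingular ⇒ PartitionMinorsHitByVP`**
(item stmt-ValiantsHypothesis-19133 with its conclusion, item stmt-ValiantsHypothesis-19717, INLINED
verbatim; `b = 10`, `h₀ = 8`): if every principal-minor layout matrix `(det K[u_i ⊔ w_j])_{i,j}` is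
nonsingular for some numeric `K`, then every minor of Nisan's partition matrix is hit by the
size-`(2h)^10` class, the witness being `f_K = det (1 + diag(x, y) · K)`. -/
theorem partitionMinorsHitByVP_of_principalMinorLayoutsNonsingular
    (hTNS : ∀ (h r : ℕ) (u w : Fin r → Finset (Fin h)), Function.Injective u → Function.Injective w →
      ∃ K : Matrix (Fin (h + h)) (Fin (h + h)) ℂ, (Matrix.of fun i j : Fin r =>
        (K.submatrix (Subtype.val : ↥((u i).map (Fin.castAddEmb h) ∪ (w j).map (Fin.natAddEmb h)) → Fin (h + h))
          (Subtype.val : ↥((u i).map (Fin.castAddEmb h) ∪ (w j).map (Fin.natAddEmb h)) → Fin (h + h))).det).det ≠ 0) :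
    ∃ b h₀ : ℕ, ∀ h : ℕ, h₀ ≤ h → ∀ (r : ℕ) (u w : Fin r → Finset (Fin h)), Function.Injective u → Function.Injective w → ∃ f ∈ Literature.Barriers.ValiantsHypothesis.SmallCircuits ℂ (h + h) b, (Matrix.of fun i j : Fin r => MvPolynomial.coeff (∑ a ∈ u i, Finsupp.single (Fin.castAdd h a) 1 + ∑ c ∈ w j, Finsupp.single (Fin.natAdd h c) 1) f).det ≠ 0 := by
  refine ⟨10, 8, fun h hh r u w hu hw => ?_⟩
  obtain ⟨K, hK⟩ := hTNS h r u w hu hw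
  refine ⟨_, pencil_mem_smallCircuits hh K, ?_⟩
  have hmat : (Matrix.of fun i j : Fin r => MvPolynomial.coeff
      (∑ a ∈ u i, Finsupp.single (Fin.castAdd h a) 1 + ∑ c ∈ w j, Finsupp.single (Fin.natAdd h c) 1)
      (pencil K).det) =
      Matrix.of fun i j : Fin r =>
        (K.submatrix (Subtype.val : ↥((u i).map (Fin.castAddEmb h) ∪ (w j).map (Fin.natAddEmb h)) → Fin (h + h))
          (Subtype.val : ↥((u i).map (Fin.castAddEmb h) ∪ (w j).map (Fin.natAddEmb h)) → Fin (h + h))).det := by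
    ext i j
    simp only [Matrix.of_apply]
    rw [mono_eq_indicator, coeff_det_pencil]
  rw [hmat]
  exact hK

end Summit.ValiantsHypothesis.ValiantsHypothesis.Theorems.BarrierLever.DiagonalPencil
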